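import Mathlib
import Literature.Combinatorics.Optimization.MaxKXorSosGap

/-!
# Schoenebeck 2008 / Tulsiani 2009 for every predicate implied by parity: linear-degree sum of
# squares (and Sherali–Adams, and every small SDP relaxation) does not beat the random-assignment
# threshold `|P⁻¹(1)|/2^k` on Max-`k`-CSP(`P`), `k ≥ 3` — PROVED

Let `P : {0,1}^k → {0,1}` be a predicate IMPLIED BY PARITY (`xor_k(y) = 1 ⇒ P(y) = 1`; e.g. the
`k`-ary disjunction, giving Max-`k`-SAT, or parity itself, giving Max-`k`-XOR).  Tulsiani's
transfer argument (STOC 2009, proof of Thm 4.11, p. 19–20 of the held text: with every instance `Φ`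
of MAX k-CSP(`P`) associate the instance `Φ'` of the implying predicate on the same literals; "if
the constraint `C'_i` is satisfied by an assignment, then so is `C_i`", and the Lasserre vectors
showing `FRAC(Φ') = m` "also show that `FRAC(Φ) = m`", while `OPT(Φ) ≤ (|P⁻¹(1)|/q^k)(1+ε) m` for a
random `Φ`) applied to Schoenebeck's `k`-XOR theorem (`MaxKXorSosGap.lean`; for the disjunction this
is Schoenebeck 2008 §5) gives, for every such `P` and `k ≥ 3`:

* `Schoenebeck2008_parityImplied_sos` — **for every `ε > 0` there are `c_ε > 0`, `n₀` with, for all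
  `n ≥ n₀`, an instance `ℑ` of Max-`literalClosure P` on `n` variables of optimum
  `≤ |P⁻¹(1)|/2^k + ε` admitting no degree-`⌊c_ε n⌋` sum-of-squares certificate of `c − ℑ` for any
  `c < 1`**;
* `Schoenebeck2008_parityImplied_SA` — the Sherali–Adams form (degree `⌊c_ε n⌋` SA does not
  `(1 − ε, |P⁻¹(1)|/2^k + ε)`-approximate), via `SAAchieves.achievesApprox`;
* `LeeRaghavendraSteurer2015_parityImplied_poly` / `_quasipoly` — no SDP relaxation of size `n^C`
  (resp. `n^{α log n / log log n}`) achieves a `(c,s)`-approximation for `|P⁻¹(1)|/2^k < s < c < 1`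
  (the tree's PROVED LRS Thm 1.6 / corrected Thm 6.4 through
  `LeeRaghavendraSteurer2015_poly_of_linearSosGap` / `_quasipoly_of_linearSosGap`).

The two ingredients beyond `MaxKXorSosGap.lean`: (i) the value count — on a fixed scope the `2^k`
literal patterns put the literal-value vector in bijection with `{0,1}^k`, so exactly `|P⁻¹(1)|`
of them satisfy the constraint (`card_filter_predGoodK_scope`); (ii) MONOTONICITY of the pseudo-
expectation — `P_i − XOR_i` is the `{0,1}`-indicator of a `k`-junta constraint, hence equal to its
own square and of degree `≤ k ≤ d/2`, so `Ẽ_D[P_i − XOR_i] ≥ 0` for the Grigoriev–Schoenebeck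
pseudo-density (`IsPseudoDensity.cubeExpect_mul_sat_nonneg`), whence `Ẽ_D[ℑ_P] ≥ Ẽ_D[ℑ_⊕] = 1`.

No definitions of facts (D-0026): every statement here is a theorem.

## References

* M. Tulsiani, *CSP gaps and reductions in the Lasserre hierarchy*, STOC 2009 [Tulsiani2009], §4.3,
  Def. 4.9 ("contains a predicate equivalent to") and the proof of Thm 4.11 (held text
  `paper:galaxy-pdf-8496938138076993900`, p. 19–20).
* G. Schoenebeck, *Linear Level Lasserre Lower Bounds for Certain k-CSPs*, FOCS 2008
  [Schoenebeck2008], §5 (from `k`-XOR to `k`-SAT).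
* J. R. Lee, P. Raghavendra, D. Steurer, STOC 2015, Thm 1.5 / 1.6 [LeeRaghavendraSteurer2015];
  P. Kothari, R. Meka, P. Raghavendra, STOC 2017, Fact 3.4 / Thm 7.5 [KothariMekaRaghavendra2017].
-/

noncomputable section

open Finset Filter
open Literature.Probability.RandomGraphs.LowDegree (walsh sgn)
open Literature.Computability.Complexity (Literal Clause kClauses clauseOf)
open Literature.Computability.MetaComplexity (ParityVec indVec clauseScope clauseVec clauseSign
  litSign IsCoverExpander VecExpands nodup_map_fst_of_mem_kClauses card_clauseScope_of_mem_kClauses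
  card_kClauses clauseSign_mul_self indVec_eq_sum card_le_of_forall_not_isCoverExpander_linear
  map_fst_clauseOf map_snd_clauseOf clauseOf_injOn)

namespace Literature.Combinatorics.Optimization

variable {k n m : ℕ}

/-! ### The constraint of a predicate on the literals of a clause -/

/-- The Max-`k`-CSP(`P`) constraint of a `k`-clause: `P` applied to the truth values of the `k`
literals of `C` (literal pattern `xorPatternK C`).
[cite: Tulsiani2009, §4.3 (proof of Thm 4.11: `C_i ≡ P(x_{i_1} + a_{i_1}, …, x_{i_k} + a_{i_k})`)] -/
def predConstraintK (P : (Fin k → Bool) → Bool) (C : ↥(kClauses k n)) :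
    CSPConstraint k n (literalClosure P) :=
  ⟨fun y => P fun j => xor (y j) (xorPatternK C j), ⟨xorPatternK C, rfl⟩, idxK C⟩

/-- Unfolding `(predConstraintK P C).sat`. [cite: Tulsiani2009, §4.3 (proof of Thm 4.11)] -/
theorem predConstraintK_sat (P : (Fin k → Bool) → Bool) (C : ↥(kClauses k n)) (x : Fin n → Bool) :
    (predConstraintK P C).sat x = P fun j => xor (x (varK C j)) (xorPatternK C j) := rfl

/-- The XOR constraint is the case `P = xor_k`. [cite: Tulsiani2009, §4.3] -/
theorem xorConstraintK_eq_predConstraintK (C : ↥(kClauses k n)) :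
    xorConstraintK C = predConstraintK (xorK k) C := rfl

/-- **"If `C'_i` is satisfied then so is `C_i`":** a predicate implied by parity is satisfied
whenever the XOR constraint on the same literals is. [cite: Tulsiani2009, §4.3 (proof of Thm 4.11, p. 19)] -/
theorem predConstraintK_sat_of_xor {P : (Fin k → Bool) → Bool} (hP : ∀ y, xorK k y = true → P y = true)
    (C : ↥(kClauses k n)) (x : Fin n → Bool) (h : (xorConstraintK C).sat x = true) :
    (predConstraintK P C).sat x = true :=
  hP _ h

/-- The difference constraint `P ∧ ¬xor_k` on the literals of `C` (a `k`-junta).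
[cite: Tulsiani2009, §4.3 (proof of Thm 4.11: `Σ C_i(α)‖V‖² ≥ Σ C'_i(α)‖V‖²`)] -/
def diffConstraintK (P : (Fin k → Bool) → Bool) (C : ↥(kClauses k n)) :
    CSPConstraint k n (literalClosure fun y => P y && !xorK k y) :=
  ⟨fun y => P (fun j => xor (y j) (xorPatternK C j)) && !xorK k (fun j => xor (y j) (xorPatternK C j)),
    ⟨xorPatternK C, rfl⟩, idxK C⟩

/-- `[P_i] − [XOR_i] = [P_i ∧ ¬XOR_i]` pointwise, for `P` implied by parity.
[cite: Tulsiani2009, §4.3 (proof of Thm 4.11)] -/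
theorem ind_pred_sub_ind_xor {P : (Fin k → Bool) → Bool} (hP : ∀ y, xorK k y = true → P y = true)
    (C : ↥(kClauses k n)) (x : Fin n → Bool) :
    ((if (predConstraintK P C).sat x then (1 : ℝ) else 0) - if (xorConstraintK C).sat x then (1 : ℝ) else 0) =
      if (diffConstraintK P C).sat x then (1 : ℝ) else 0 := by
  have himp := predConstraintK_sat_of_xor hP C x
  have hdiff : (diffConstraintK P C).sat x =
      ((predConstraintK P C).sat x && !(xorConstraintK C).sat x) := rfl
  rw [hdiff]
  revert himp
  cases (predConstraintK P C).sat x <;> cases (xorConstraintK C).sat x <;> simp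

/-- **Monotonicity of pseudo-expectations on junta indicators:** for a degree-`d` pseudo-density
`D` and any constraint `C` on `k ≤ d/2` variables, `Ẽ_D[1_C] ≥ 0` — the indicator is `{0,1}`-valued,
hence its own square, and has degree `≤ k` (`CSPConstraint.hasDegreeLE_sat`).
[cite: Tulsiani2009, §4.3 (proof of Thm 4.11: the vectors' squared norms are nonnegative)]
[cite: LeeRaghavendraSteurer2015, §2 (pseudo-densities)] -/
theorem IsPseudoDensity.cubeExpect_mul_sat_nonneg {d : ℕ} {D : (Fin n → Bool) → ℝ}
    {Q : Set ((Fin k → Bool) → Bool)} (hD : IsPseudoDensity d D) (C : CSPConstraint k n Q)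
    (hkd : k ≤ d / 2) :
    0 ≤ cubeExpect (fun x => D x * if C.sat x then (1 : ℝ) else 0) := by
  have hdeg : HasDegreeLE (d / 2) (fun x => if C.sat x then (1 : ℝ) else 0) :=
    (CSPConstraint.hasDegreeLE_sat C).mono hkd
  have h := hD.2 _ hdeg
  have hsq : (fun x => D x * (if C.sat x then (1 : ℝ) else 0) ^ 2) =
      fun x => D x * if C.sat x then (1 : ℝ) else 0 := by
    funext x; split_ifs <;> simp
  rwa [hsq] at h

variable {m : ℕ}

/-- **The Max-`k`-CSP(`P`) instance of a clause tuple.** [cite: Tulsiani2009, §4.3 (proof of Thm 4.11)] -/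
def predInstanceK (P : (Fin k → Bool) → Bool) (ω : Fin m → ↥(kClauses k n)) (hm : 0 < m) :
    CSPInstance k n (literalClosure P) :=
  ⟨m, hm, fun i => predConstraintK P (ω i)⟩

/-- The value of the instance at `x` as a count. [cite: Tulsiani2009, §4.3] -/
theorem predInstanceK_val (P : (Fin k → Bool) → Bool) (ω : Fin m → ↥(kClauses k n)) (hm : 0 < m)
    (x : Fin n → Bool) :
    (predInstanceK P ω hm).val x =
      ((univ.filter fun i : Fin m => (predConstraintK P (ω i)).sat x = true).card : ℝ) / m := by
  unfold CSPInstance.val predInstanceK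
  simp only
  congr 1
  rw [← Finset.sum_boole]

/-- **`ℑ_P = ℑ_⊕ + (1/m) Σ_i [P_i ∧ ¬XOR_i]` pointwise.** [cite: Tulsiani2009, §4.3 (proof of Thm 4.11)] -/
theorem predInstanceK_val_eq {P : (Fin k → Bool) → Bool} (hP : ∀ y, xorK k y = true → P y = true)
    (ω : Fin m → ↥(kClauses k n)) (hm : 0 < m) (x : Fin n → Bool) :
    (predInstanceK P ω hm).val x = (xorInstanceK ω hm).val x +
      (1 / (m : ℝ)) * ∑ i : Fin m, (if (diffConstraintK P (ω i)).sat x then (1 : ℝ) else 0) := by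
  unfold CSPInstance.val predInstanceK xorInstanceK
  simp only
  rw [← Finset.sum_congr rfl fun i _ => ind_pred_sub_ind_xor hP (ω i) x, Finset.sum_sub_distrib]
  have hmr : (m : ℝ) ≠ 0 := by exact_mod_cast hm.ne'
  field_simp
  ring

/-! ### The marginal: exactly `|P⁻¹(1)|` of the `2^k` patterns on a scope satisfy the constraint -/

/-- The variables of `clauseOf S ε` do not depend on the sign vector `ε`. [cite: Tulsiani2009, §2 (random instances: scope and literals independent)] -/
theorem varK_clauseOf_eq {S : Finset (Fin n)} (ε ε' : ℕ → Bool) (h : clauseOf S ε ∈ kClauses k n)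
    (h' : clauseOf S ε' ∈ kClauses k n) (j : Fin k) :
    varK ⟨clauseOf S ε, h⟩ j = varK ⟨clauseOf S ε', h'⟩ j := by
  have hlen : (clauseOf S ε).length = k := length_of_mem_kClauses h
  have hlen' : (clauseOf S ε').length = k := length_of_mem_kClauses h'
  apply Fin.ext
  show (litK ⟨clauseOf S ε, h⟩ j).1 = (litK ⟨clauseOf S ε', h'⟩ j).1
  have e1 : ((clauseOf S ε).map Prod.fst)[j.1]'(by simp [hlen]) = (litK ⟨clauseOf S ε, h⟩ j).1 :=
    List.getElem_map ..
  have e2 : ((clauseOf S ε').map Prod.fst)[j.1]'(by simp [hlen']) = (litK ⟨clauseOf S ε', h'⟩ j).1 :=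
    List.getElem_map ..
  rw [← e1, ← e2]
  simp only [map_fst_clauseOf]

/-- **On a fixed scope, exactly `|P⁻¹(1)|` of the `2^k` literal patterns satisfy the `P`-constraint
at `x`** (the literal-value vector runs through `{0,1}^k` bijectively).
[cite: Tulsiani2009, §4.3 (p. 18: "a random assignment satisfies `|P⁻¹(1)|/q^k` fraction of constraints")] -/
theorem card_filter_predGoodK_scope (P : (Fin k → Bool) → Bool) {S : Finset (Fin n)}
    (hS : S.card = k) (x : Fin n → Bool) :
    ((univ : Finset (Fin k → Bool)).filter fun e => ∃ h : clauseOf S (extK e) ∈ kClauses k n,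
      (predConstraintK P ⟨clauseOf S (extK e), h⟩).sat x = true).card =
      ((univ : Finset (Fin k → Bool)).filter fun y => P y = true).card := by
  classical
  have h₀ := clauseOf_extK_mem (n := n) hS (fun _ => false)
  set z : Fin k → Bool := fun j => x (varK ⟨clauseOf S (extK fun _ => false), h₀⟩ j) with hz
  set τ : (Fin k → Bool) → (Fin k → Bool) := fun e j => xor (z j) (!e j) with hτ
  set τ' : (Fin k → Bool) → (Fin k → Bool) := fun y j => !(xor (z j) (y j)) with hτ'
  have hiff : ∀ e : Fin k → Bool, (∃ h : clauseOf S (extK e) ∈ kClauses k n,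
      (predConstraintK P ⟨clauseOf S (extK e), h⟩).sat x = true) ↔ P (τ e) = true := by
    intro e
    have hmem := clauseOf_extK_mem hS e
    rw [exists_prop_of_true hmem, predConstraintK_sat]
    have harg : (fun j => xor (x (varK ⟨clauseOf S (extK e), hmem⟩ j))
        (xorPatternK ⟨clauseOf S (extK e), hmem⟩ j)) = τ e := by
      funext j
      rw [hτ, xorPatternK, litK_clauseOf_snd _ hmem j, varK_clauseOf_eq _ _ hmem h₀ j, extK,
        dif_pos j.2]
    rw [harg]
  rw [Finset.filter_congr fun e _ => hiff e]
  refine Finset.card_nbij' τ τ' (fun e he => ?_) (fun y hy => ?_) (fun e _ => ?_) (fun y _ => ?_)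
  · rw [Finset.mem_coe, Finset.mem_filter] at he ⊢
    exact ⟨Finset.mem_univ _, he.2⟩
  · rw [Finset.mem_coe, Finset.mem_filter] at hy ⊢
    refine ⟨Finset.mem_univ _, ?_⟩
    have : τ (τ' y) = y := by
      funext j; simp only [hτ, hτ']; cases z j <;> cases y j <;> rfl
    rw [this]; exact hy.2
  · funext j; simp only [hτ, hτ']; cases z j <;> cases e j <;> rfl
  · funext j; simp only [hτ, hτ']; cases z j <;> cases y j <;> rfl

/-- **At most (in fact exactly) a `|P⁻¹(1)|/2^k` fraction of the `k`-clauses have their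
`P`-constraint true under a fixed assignment.** [cite: Tulsiani2009, §4.3 (p. 18)] -/
theorem card_filter_predGoodK_le (P : (Fin k → Bool) → Bool) (x : Fin n → Bool) :
    (((univ : Finset ↥(kClauses k n)).filter fun C => (predConstraintK P C).sat x = true).card : ℝ) ≤
      (((univ : Finset (Fin k → Bool)).filter fun y => P y = true).card / 2 ^ k : ℝ) *
        Fintype.card ↥(kClauses k n) := by
  classical
  set NP := ((univ : Finset (Fin k → Bool)).filter fun y => P y = true).card with hNP
  set dom := ((univ : Finset (Fin n)).powersetCard k) ×ˢ (univ : Finset (Fin k → Bool)) with hdom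
  set Q : Clause ℕ → Prop := fun C => ∃ h : C ∈ kClauses k n,
    (predConstraintK P ⟨C, h⟩).sat x = true with hQ
  have hinj : Set.InjOn (fun q : Finset (Fin n) × (Fin k → Bool) => clauseOf q.1 (extK q.2)) ↑dom :=
    clauseOf_injOn k n
  have h1 : ((univ : Finset ↥(kClauses k n)).filter fun C => (predConstraintK P C).sat x = true).card ≤
      ((kClauses k n).filter Q).card := by
    refine Finset.card_le_card_of_injOn (fun C => C.1) (fun C hC => ?_)
      (fun a _ b _ h => Subtype.ext h)
    simp only [Finset.coe_filter, Finset.mem_univ, true_and, Set.mem_setOf_eq] at hC ⊢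
    exact ⟨C.2, C.2, hC⟩
  have h2 : ((kClauses k n).filter Q).card =
      (dom.filter fun q => Q (clauseOf q.1 (extK q.2))).card := by
    have himg : (dom.filter fun q => Q (clauseOf q.1 (extK q.2))).image
        (fun q : Finset (Fin n) × (Fin k → Bool) => clauseOf q.1 (extK q.2)) =
        (kClauses k n).filter Q := by
      ext C
      have hK : C ∈ kClauses k n ↔ ∃ q ∈ dom, clauseOf q.1 (extK q.2) = C := by
        rw [kClauses_eq_image_extK, Finset.mem_image]
      simp only [Finset.mem_image, Finset.mem_filter, hK]
      constructor
      · rintro ⟨q, ⟨hq, hPq⟩, rfl⟩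
        exact ⟨⟨q, hq, rfl⟩, hPq⟩
      · rintro ⟨⟨q, hq, rfl⟩, hPq⟩
        exact ⟨q, ⟨hq, hPq⟩, rfl⟩
    rw [← himg, Finset.card_image_of_injOn (hinj.mono (Finset.coe_subset.2 (Finset.filter_subset _ _)))]
  have h4 : (dom.filter fun q => Q (clauseOf q.1 (extK q.2))).card = n.choose k * NP := by
    rw [Finset.card_filter, hdom, Finset.sum_product]
    calc ∑ S ∈ (univ : Finset (Fin n)).powersetCard k, ∑ e ∈ (univ : Finset (Fin k → Bool)),
          (if Q (clauseOf (S, e).1 (extK (S, e).2)) then 1 else 0)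
        = ∑ S ∈ (univ : Finset (Fin n)).powersetCard k,
            ((univ : Finset (Fin k → Bool)).filter fun e => Q (clauseOf S (extK e))).card := by
          refine Finset.sum_congr rfl fun S _ => ?_
          rw [Finset.card_filter]
      _ = ∑ _S ∈ (univ : Finset (Fin n)).powersetCard k, NP := by
          refine Finset.sum_congr rfl fun S hS => ?_
          exact card_filter_predGoodK_scope P (Finset.mem_powersetCard.1 hS).2 x
      _ = n.choose k * NP := by
          rw [Finset.sum_const, Finset.card_powersetCard, Finset.card_univ, Fintype.card_fin,
            smul_eq_mul]
  have hcard : Fintype.card ↥(kClauses k n) = n.choose k * 2 ^ k := by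
    rw [Fintype.card_coe, card_kClauses]
  rw [hcard]
  have h5 : (((univ : Finset ↥(kClauses k n)).filter fun C =>
      (predConstraintK P C).sat x = true).card : ℝ) ≤ ((n.choose k * NP : ℕ) : ℝ) := by
    exact_mod_cast h1.trans (h2.trans h4).le
  have h2k : (0 : ℝ) < 2 ^ k := by positivity
  calc _ ≤ ((n.choose k * NP : ℕ) : ℝ) := h5
    _ = ((NP : ℝ) / 2 ^ k) * ((n.choose k * 2 ^ k : ℕ) : ℝ) := by
        push_cast; field_simp

/-- `|P⁻¹(1)| ≤ 2^k`. [folklore] -/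
private theorem card_filter_pred_le (P : (Fin k → Bool) → Bool) :
    ((univ : Finset (Fin k → Bool)).filter fun y => P y = true).card ≤ 2 ^ k := by
  calc _ ≤ (univ : Finset (Fin k → Bool)).card := Finset.card_filter_le _ _
    _ = 2 ^ k := by rw [Finset.card_univ, Fintype.card_fun, Fintype.card_bool, Fintype.card_fin]

/-! ### Good tuples: expansion and value `≤ |P⁻¹(1)|/2^k + ε` -/

/-- **Good tuples exist** for Max-`k`-CSP(`P`): for `k ≥ 3` and `0 < ε ≤ 1` there are `Δ ≥ 1`,
`κ > 0`, `n₀` such that for every `n ≥ n₀` some tuple of `Δ n` clauses is a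
`(⌊κn⌋, (2k+1)/4)`-cover expander all of whose assignments satisfy at most
`(|P⁻¹(1)|/2^k + ε) Δn` of its `P`-constraints (`Δ = ⌈2^{k+1}/ε²⌉`; when `P ≡ 1` the value clause
is vacuous). [cite: Tulsiani2009, Lemma 2.2 and §4.3 (proof of Thm 4.11: `OPT(Φ) ≤ (|P⁻¹(1)|/q^k)(1+ε) m`)] -/
theorem exists_good_predTupleK (hk : 3 ≤ k) (P : (Fin k → Bool) → Bool) {ε : ℝ} (hε0 : 0 < ε)
    (hε1 : ε ≤ 1) :
    ∃ Δ : ℕ, 1 ≤ Δ ∧ ∃ κ : ℝ, 0 < κ ∧ ∃ n₀ : ℕ, ∀ n : ℕ, n₀ ≤ n →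
      ∃ ω : Fin (Δ * n) → ↥(kClauses k n),
        IsCoverExpander (fun i => clauseScope (ω i).1) (⌊κ * n⌋₊ : ℕ) ((2 * k + 1) / 4) ∧
        (∀ x : Fin n → Bool, ((univ.filter fun i : Fin (Δ * n) =>
            (predConstraintK P (ω i)).sat x = true).card : ℝ) ≤
          ((((univ : Finset (Fin k → Bool)).filter fun y => P y = true).card / 2 ^ k : ℝ) + ε) *
            (Δ * n : ℕ)) := by
  classical
  set NP := ((univ : Finset (Fin k → Bool)).filter fun y => P y = true).card with hNP
  have hNPle : NP ≤ 2 ^ k := card_filter_pred_le P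
  set p : ℝ := (NP : ℝ) / 2 ^ k with hp
  have h2k : (0 : ℝ) < 2 ^ k := by positivity
  have hp0 : 0 ≤ p := by rw [hp]; positivity
  have hp1 : p ≤ 1 := by
    rw [hp, div_le_one h2k]; exact_mod_cast hNPle
  -- constants
  set Δ : ℕ := ⌈2 ^ (k + 1) / ε ^ 2⌉₊ with hΔdef
  have hΔge : (2 : ℝ) ^ (k + 1) / ε ^ 2 ≤ (Δ : ℝ) := Nat.le_ceil _
  have hε2 : 0 < ε ^ 2 := by positivity
  have hΔ1 : 1 ≤ Δ := by
    have h2k1 : (1 : ℝ) ≤ 2 ^ (k + 1) := one_le_pow₀ (by norm_num)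
    have : (1 : ℝ) ≤ 2 ^ (k + 1) / ε ^ 2 := by
      rw [le_div_iff₀ hε2]; nlinarith
    have h : (1 : ℝ) ≤ Δ := by linarith
    exact_mod_cast h
  set a : ℝ := (2 * k + 1) / 4 with ha
  have hapos : 0 < a := by rw [ha]; positivity
  set B : ℝ := Real.exp (1 + a) * Δ * a with hB
  have hBpos : 0 < B := by rw [hB]; positivity
  set κ : ℝ := 1 / (a * (2 * B) ^ 4) with hκ
  have hκpos : 0 < κ := by rw [hκ]; positivity
  refine ⟨Δ, hΔ1, κ, hκpos, max k ⌈128 * a * B ^ 4⌉₊, fun n hn => ?_⟩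
  have hkn : k ≤ n := le_of_max_le_left hn
  have hn1 : 1 ≤ n := by omega
  have hnr : (0 : ℝ) < n := by exact_mod_cast hn1
  have hnB : 128 * a * B ^ 4 ≤ n := (Nat.le_ceil _).trans (by exact_mod_cast le_of_max_le_right hn)
  -- the clause space
  have hKc : (kClauses k n).card = n.choose k * 2 ^ k := card_kClauses k n
  have hK : (kClauses k n).Nonempty := by
    rw [← Finset.card_pos, hKc]
    exact Nat.mul_pos (Nat.choose_pos hkn) (by positivity)
  set X := ↥(kClauses k n)
  set m := Δ * n with hm
  have hcardX : (Fintype.card X : ℝ) = (kClauses k n).card := by rw [Fintype.card_coe]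
  set T : ℝ := ((kClauses k n).card : ℝ) ^ m with hT
  have hTpos : 0 < T := by rw [hT]; exact pow_pos (by exact_mod_cast Finset.card_pos.2 hK) _
  -- the two bad sets
  set badExp : Finset (Fin m → X) := univ.filter fun ω =>
    ¬ IsCoverExpander (fun i => clauseScope (ω i).1) (⌊κ * n⌋₊ : ℕ) ((2 * k + 1) / 4) with hbadExp
  set badVal : Finset (Fin m → X) := univ.filter fun ω => ∃ σ : Fin n → Bool,
    (p + ε) * m < ((univ.filter fun i => (predConstraintK P (ω i)).sat σ = true).card : ℝ)
    with hbadVal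
  -- (1) expansion failures
  have h1 : (badExp.card : ℝ) ≤ T / 4 := by
    have hN : a * (⌊κ * n⌋₊ : ℕ) ≤ n / (2 * B) ^ 4 := by
      have hf : ((⌊κ * n⌋₊ : ℕ) : ℝ) ≤ κ * n := Nat.floor_le (by positivity)
      have : a * (κ * n) = n / (2 * B) ^ 4 := by
        rw [hκ]; field_simp
      calc a * (⌊κ * n⌋₊ : ℕ) ≤ a * (κ * n) := by gcongr
        _ = n / (2 * B) ^ 4 := this
    have h := card_le_of_forall_not_isCoverExpander_linear (k := k) (Δ := Δ) (n := n)
      (N := ⌊κ * n⌋₊) (a := a) (B := B) hk hΔ1 hn1 hK ha hB hN badExp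
      (fun c hc => (Finset.mem_filter.1 hc).2)
    have hcoef : 32 * a * B ^ 4 / n ≤ 1 / 4 := by
      rw [div_le_iff₀ hnr]
      calc (32 : ℝ) * a * B ^ 4 = 1 / 4 * (128 * a * B ^ 4) := by ring
        _ ≤ 1 / 4 * (n : ℝ) := by gcongr
    calc (badExp.card : ℝ) ≤ 32 * a * B ^ 4 / n * ((((kClauses k n).card ^ (Δ * n) : ℕ)) : ℝ) := h
      _ ≤ 1 / 4 * T := by
          rw [hT, hm]; push_cast
          exact mul_le_mul_of_nonneg_right hcoef (by positivity)
      _ = T / 4 := by ring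
  -- (2) value failures: empty if `P ≡ 1`, exponentially few otherwise
  have h2 : (badVal.card : ℝ) ≤ 2 / 7 * T := by
    rcases Nat.lt_or_ge NP (2 ^ k) with hlt | hge
    · -- `p ≤ 1 − 2^{−k}`
      have hp' : p ≤ 1 - 1 / 2 ^ k := by
        have h1' : (NP : ℝ) ≤ 2 ^ k - 1 := by
          have : NP + 1 ≤ 2 ^ k := hlt
          have h'' : ((NP + 1 : ℕ) : ℝ) ≤ ((2 ^ k : ℕ) : ℝ) := by exact_mod_cast this
          push_cast at h''; linarith
        rw [hp, div_le_iff₀ h2k, sub_mul, one_mul, div_mul_cancel₀ _ h2k.ne']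
        exact h1'
      have h := card_filter_exists_manyGood_le (n := n) (X := X)
        (fun σ C => (predConstraintK P C).sat σ = true)
        (p := p) (ε := ε) hp0 (fun σ => card_filter_predGoodK_le P σ) hε0.le hε1 m
      rw [hcardX] at h
      have hq : (2 : ℝ) ≤ (1 - p) * ε ^ 2 * Δ := by
        have : (2 : ℝ) ^ (k + 1) ≤ ε ^ 2 * Δ := by
          calc (2 : ℝ) ^ (k + 1) = ε ^ 2 * (2 ^ (k + 1) / ε ^ 2) := by field_simp
            _ ≤ ε ^ 2 * Δ := by gcongr
        have h1p : 1 / 2 ^ k ≤ 1 - p := by linarith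
        calc (2 : ℝ) = 1 / 2 ^ k * 2 ^ (k + 1) := by field_simp; ring
          _ ≤ (1 - p) * (ε ^ 2 * Δ) := by gcongr
          _ = (1 - p) * ε ^ 2 * Δ := by ring
      have h2n := two_pow_mul_exp_neg_two_mul_le hn1
      have hexple : Real.exp (-((1 - p) * ε ^ 2 * (m : ℕ))) ≤ Real.exp (-(2 * n)) := by
        rw [Real.exp_le_exp, hm]; push_cast; nlinarith
      have h3 : (2 : ℝ) ^ n * Real.exp (-((1 - p) * ε ^ 2 * (m : ℕ))) ≤ 2 / 7 :=
        le_trans (by gcongr) h2n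
      calc (badVal.card : ℝ) ≤ 2 ^ n * (((kClauses k n).card : ℝ) ^ m *
            Real.exp (-((1 - p) * ε ^ 2 * m))) := h
        _ = 2 ^ n * Real.exp (-((1 - p) * ε ^ 2 * (m : ℕ))) * T := by rw [hT]; ring
        _ ≤ 2 / 7 * T := mul_le_mul_of_nonneg_right h3 hTpos.le
    · -- `P ≡ 1`: the value bound is vacuous
      have hp1' : p = 1 := by
        have : NP = 2 ^ k := le_antisymm hNPle hge
        rw [hp, this]; push_cast; field_simp
      have hempty : badVal = ∅ := by
        rw [hbadVal, Finset.filter_eq_empty_iff]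
        intro ω _ ⟨σ, hσ⟩
        have hle : ((univ.filter fun i => (predConstraintK P (ω i)).sat σ = true).card : ℝ) ≤ m := by
          have := Finset.card_filter_le (univ : Finset (Fin m))
            (fun i => (predConstraintK P (ω i)).sat σ = true)
          rw [Finset.card_univ, Fintype.card_fin] at this
          exact_mod_cast this
        have hm0 : (0 : ℝ) ≤ m := Nat.cast_nonneg _
        rw [hp1'] at hσ
        nlinarith
      rw [hempty, Finset.card_empty]; push_cast; positivity
  -- a tuple outside the two bad sets
  have hlt : ((badExp ∪ badVal).card : ℝ) < (univ : Finset (Fin m → X)).card := by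
    have hU : ((univ : Finset (Fin m → X)).card : ℝ) = T := by
      rw [Finset.card_univ, Fintype.card_fun, Fintype.card_fin, hT, Nat.cast_pow, hcardX]
    have hu : ((badExp ∪ badVal).card : ℝ) ≤ badExp.card + badVal.card := by
      exact_mod_cast Finset.card_union_le badExp badVal
    rw [hU]
    linarith
  have hne : ((univ : Finset (Fin m → X)) \ (badExp ∪ badVal)).Nonempty := by
    rw [Finset.nonempty_iff_ne_empty]
    intro h
    have := Finset.card_sdiff_add_card_eq_card (Finset.subset_univ (badExp ∪ badVal))
    rw [h, Finset.card_empty, zero_add] at this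
    rw [this] at hlt
    exact lt_irrefl _ hlt
  obtain ⟨ω, hω⟩ := hne
  rw [Finset.mem_sdiff, Finset.mem_union, not_or] at hω
  obtain ⟨-, hωE, hωV⟩ := hω
  refine ⟨ω, ?_, fun x => ?_⟩
  · by_contra hc
    exact hωE (Finset.mem_filter.2 ⟨Finset.mem_univ _, hc⟩)
  · by_contra hc
    push Not at hc
    exact hωV (Finset.mem_filter.2 ⟨Finset.mem_univ _, x, hc⟩)

/-! ### The pseudo-expected value is at least `1` -/

/-- **`Ẽ_D[ℑ_P] ≥ 1`** for the Grigoriev–Schoenebeck pseudo-density of degree `d ≥ 2k` of an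
expanding tuple and a predicate implied by parity: `Ẽ_D[ℑ_⊕] = 1`
(`cubeExpect_gsDensity_mul_xorInstanceK_val`) and `Ẽ_D[P_i − XOR_i] ≥ 0`
(`IsPseudoDensity.cubeExpect_mul_sat_nonneg`).
[cite: Tulsiani2009, §4.3 (proof of Thm 4.11: `Σ_i Σ_α C_i(α)‖V_{(T_i,α)}‖² ≥ Σ_i Σ_α C'_i(α)‖V_{(T_i,α)}‖² = m`)] -/
theorem one_le_cubeExpect_gsDensity_mul_predInstanceK_val {P : (Fin k → Bool) → Bool}
    (hP : ∀ y, xorK k y = true → P y = true) (ω : Fin m → ↥(kClauses k n)) (hm : 0 < m)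
    {N : ℝ} {d : ℕ} (hexp : IsCoverExpander (fun i => clauseScope (ω i).1) N ((2 * k + 1) / 4))
    (hN : 2 ≤ N) (hd : (d : ℝ) ≤ 1 / 2 * N / 2) (hkd : k ≤ d / 2) :
    1 ≤ cubeExpect (fun x => gsDensity n (tupleVecsK ω) (tupleSatSignsK ω) N d x *
      (predInstanceK P ω hm).val x) := by
  classical
  have hvec := vecExpands_tupleVecsK ω hexp
  have hb : ∀ i, tupleSatSignsK ω i * tupleSatSignsK ω i = 1 := fun i => clauseSign_mul_self _
  have hD := isPseudoDensity_gsDensity (n := n) (b := tupleSatSignsK ω) hvec (by norm_num) hd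
    (by linarith) hb
  set D := gsDensity n (tupleVecsK ω) (tupleSatSignsK ω) N d with hDdef
  have hfun : (fun x => D x * (predInstanceK P ω hm).val x) = fun x => D x *
      ((xorInstanceK ω hm).val x +
        (1 / (m : ℝ)) * ∑ i : Fin m, (if (diffConstraintK P (ω i)).sat x then (1 : ℝ) else 0)) := by
    funext x; rw [predInstanceK_val_eq hP ω hm x]
  rw [hfun, cubeExpect_mul_add, cubeExpect_gsDensity_mul_xorInstanceK_val ω hm hexp hN hd
    (le_trans hkd (Nat.div_le_self d 2)), cubeExpect_mul_const_mul, cubeExpect_mul_finset_sum]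
  have hnonneg : 0 ≤ ∑ i ∈ (univ : Finset (Fin m)),
      cubeExpect (fun x => D x * if (diffConstraintK P (ω i)).sat x then (1 : ℝ) else 0) :=
    Finset.sum_nonneg fun i _ => hD.cubeExpect_mul_sat_nonneg (diffConstraintK P (ω i)) hkd
  have hm0 : (0 : ℝ) ≤ 1 / (m : ℝ) := by positivity
  nlinarith

/-! ### The theorems -/

/-- Degree bookkeeping: for `κ n ≥ 64 k + 128`, `d = ⌊κ n/32⌋` has `2k ≤ d`, hence `k ≤ d/2`.
[cite: Tulsiani2009, §4.3 (number of rounds `Ω(n)`)] -/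
theorem two_mul_le_floor_of_le {κ : ℝ} (hκn : 64 * (k : ℝ) + 128 ≤ κ * n) :
    2 * k ≤ ⌊κ / 32 * n⌋₊ := by
  refine Nat.le_floor ?_
  push_cast
  linarith

/-- **Schoenebeck 2008 / Tulsiani 2009 for every predicate implied by parity, all `k ≥ 3` —
PROVED.** Let `P : {0,1}^k → {0,1}` with `xor_k ⇒ P`.  For every `ε > 0` there are `c_ε > 0` and
`n₀` such that for every `n ≥ n₀` some instance `ℑ` of Max-`k`-CSP(`P`) (with literals) on `n`
variables has `opt ≤ |P⁻¹(1)|/2^k + ε` while no `c < 1` has a degree-`⌊c_ε n⌋` sum-of-squares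
certificate of `c − ℑ` on `{0,1}ⁿ` (Lasserre value `1` after `⌊c_ε n⌋` rounds: integrality gap
`2^k/|P⁻¹(1)| − O(ε)`).  Special cases: Max-`k`-SAT (`Schoenebeck2008_maxKSatSos`), Max-`k`-XOR
(`Schoenebeck2008_maxKXorSos`).
[cite: Tulsiani2009, proof of Thm 4.11 (p. 19–20) with Def. 4.9] [cite: Schoenebeck2008, §5] -/
theorem Schoenebeck2008_parityImplied_sos (hk : 3 ≤ k) {P : (Fin k → Bool) → Bool}
    (hP : ∀ y, xorK k y = true → P y = true) :
    ∀ ε : ℝ, 0 < ε → ∃ cε : ℝ, 0 < cε ∧ ∃ n₀ : ℕ, ∀ n : ℕ, n₀ ≤ n →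
      ∃ I : CSPInstance k n (literalClosure P),
        I.OptLE (((univ : Finset (Fin k → Bool)).filter fun y => P y = true).card / 2 ^ k + ε) ∧
        ∀ c : ℝ, c < 1 → ¬ HasSosCertificate ⌊cε * n⌋₊ (fun x => c - I.val x) := by
  intro ε hε
  classical
  set ε' : ℝ := min ε 1 with hε'
  have hε'0 : 0 < ε' := lt_min hε one_pos
  have hε'1 : ε' ≤ 1 := min_le_right _ _
  have hε'ε : ε' ≤ ε := min_le_left _ _
  obtain ⟨Δ, hΔ, κ, hκ, n₀, H⟩ := exists_good_predTupleK hk P hε'0 hε'1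
  refine ⟨κ / 32, by positivity, max n₀ ⌈(64 * k + 128) / κ⌉₊, fun n hn => ?_⟩
  have hn₀ : n₀ ≤ n := le_of_max_le_left hn
  have hκn : 64 * k + 128 ≤ κ * n := by
    have h1 : (⌈(64 * k + 128) / κ⌉₊ : ℝ) ≤ n := by exact_mod_cast le_of_max_le_right hn
    have h2 : (64 * k + 128) / κ ≤ n := (Nat.le_ceil _).trans h1
    rw [div_le_iff₀ hκ] at h2
    linarith
  have hk0 : (0 : ℝ) ≤ k := by positivity
  obtain ⟨hN2, hd2, hdN⟩ := degree_bookkeeping hκ (by linarith)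
  obtain ⟨ω, hexp, hval⟩ := H n hn₀
  have hn1 : 1 ≤ n := by
    by_contra h; push Not at h
    have : n = 0 := by omega
    rw [this] at hκn; simp at hκn; linarith
  have hm : 0 < Δ * n := Nat.mul_pos (by omega) (by omega)
  set d : ℕ := ⌊κ / 32 * n⌋₊ with hddef
  have h2kd : 2 * k ≤ d := two_mul_le_floor_of_le hκn
  have hkd2 : k ≤ d / 2 := by omega
  have hdle : (d : ℝ) ≤ 1 / 2 * ((⌊κ * n⌋₊ : ℕ) : ℝ) / 2 := by
    have : (d : ℝ) ≤ ((2 * d : ℕ) : ℝ) := by push_cast; linarith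
    exact this.trans hdN
  refine ⟨predInstanceK P ω hm, fun x => ?_, fun c hc hsos => ?_⟩
  · rw [predInstanceK_val P ω hm x, div_le_iff₀ (by exact_mod_cast hm)]
    calc _ ≤ (_ + ε') * (Δ * n : ℕ) := hval x
      _ ≤ (((univ : Finset (Fin k → Bool)).filter fun y => P y = true).card / 2 ^ k + ε) *
            (Δ * n : ℕ) := by push_cast; gcongr
      _ = _ := by push_cast; ring
  · have hvec := vecExpands_tupleVecsK ω hexp
    have hb : ∀ i, tupleSatSignsK ω i * tupleSatSignsK ω i = 1 := fun i => clauseSign_mul_self _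
    have hD := isPseudoDensity_gsDensity (n := n) (b := tupleSatSignsK ω) hvec (by norm_num) hdle
      (by linarith) hb
    have h0 := hD.cubeExpect_mul_nonneg hsos
    have h1 := one_le_cubeExpect_gsDensity_mul_predInstanceK_val hP ω hm hexp hN2 hdle hkd2
    rw [cubeExpect_mul_sub, cubeExpect_mul_const, hD.1] at h0
    linarith

/-- **The Sherali–Adams form (shape of KMR Thm 7.5), every predicate implied by parity, `k ≥ 3` —
PROVED:** for every `ε > 0` there are `c_ε > 0`, `n₀` such that for `n ≥ n₀` the degree-`⌊c_ε n⌋`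
Sherali–Adams relaxation fails to `(1 − ε, |P⁻¹(1)|/2^k + ε)`-approximate Max-`k`-CSP(`P`) on `n`
variables (pseudo-density of degree `2d`, `SAAchieves.achievesApprox`).
[cite: Tulsiani2009, proof of Thm 4.11 (p. 19–20)] [cite: KothariMekaRaghavendra2017, Thm 7.5 and Fact 3.4] -/
theorem Schoenebeck2008_parityImplied_SA (hk : 3 ≤ k) {P : (Fin k → Bool) → Bool}
    (hP : ∀ y, xorK k y = true → P y = true) :
    ∀ ε : ℝ, 0 < ε → ∃ cε : ℝ, 0 < cε ∧ ∃ n₀ : ℕ, ∀ n : ℕ, n₀ ≤ n →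
      ¬ SAAchieves (n := n) (literalClosure P) ⌊cε * n⌋₊ (1 - ε)
        (((univ : Finset (Fin k → Bool)).filter fun y => P y = true).card / 2 ^ k + ε) := by
  intro ε hε
  classical
  set ε' : ℝ := min ε 1 with hε'
  have hε'0 : 0 < ε' := lt_min hε one_pos
  have hε'1 : ε' ≤ 1 := min_le_right _ _
  have hε'ε : ε' ≤ ε := min_le_left _ _
  obtain ⟨Δ, hΔ, κ, hκ, n₀, H⟩ := exists_good_predTupleK hk P hε'0 hε'1
  refine ⟨κ / 32, by positivity, max n₀ ⌈(64 * k + 128) / κ⌉₊, fun n hn hSA => ?_⟩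
  have hn₀ : n₀ ≤ n := le_of_max_le_left hn
  have hκn : 64 * k + 128 ≤ κ * n := by
    have h1 : (⌈(64 * k + 128) / κ⌉₊ : ℝ) ≤ n := by exact_mod_cast le_of_max_le_right hn
    have h2 : (64 * k + 128) / κ ≤ n := (Nat.le_ceil _).trans h1
    rw [div_le_iff₀ hκ] at h2
    linarith
  have hk0 : (0 : ℝ) ≤ k := by positivity
  obtain ⟨hN2, hd2, hdN⟩ := degree_bookkeeping hκ (by linarith)
  obtain ⟨ω, hexp, hval⟩ := H n hn₀
  have hn1 : 1 ≤ n := by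
    by_contra h; push Not at h
    have : n = 0 := by omega
    rw [this] at hκn; simp at hκn; linarith
  have hm : 0 < Δ * n := Nat.mul_pos (by omega) (by omega)
  set d : ℕ := ⌊κ / 32 * n⌋₊ with hddef
  have h2kd : 2 * k ≤ d := two_mul_le_floor_of_le hκn
  have hkd' : k ≤ (2 * d) / 2 := by omega
  -- soundness
  have hopt : (predInstanceK P ω hm).OptLE
      (((univ : Finset (Fin k → Bool)).filter fun y => P y = true).card / 2 ^ k + ε) := by
    intro x
    rw [predInstanceK_val P ω hm x, div_le_iff₀ (by exact_mod_cast hm)]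
    calc _ ≤ (_ + ε') * (Δ * n : ℕ) := hval x
      _ ≤ (((univ : Finset (Fin k → Bool)).filter fun y => P y = true).card / 2 ^ k + ε) *
            (Δ * n : ℕ) := by push_cast; gcongr
      _ = _ := by push_cast; ring
  -- Sherali–Adams ⇒ subspace sos of degree `d` ⇒ certificate of degree `2d`
  have hsub : SubspaceSos (degreeLE n ((2 * d) / 2)) (predInstanceK P ω hm).val (1 - ε) := by
    rw [Nat.mul_div_cancel_left d two_pos]
    exact hSA.achievesApprox (predInstanceK P ω hm) hopt
  rw [subspaceSos_degreeLE_iff] at hsub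
  have hvec := vecExpands_tupleVecsK ω hexp
  have hb : ∀ i, tupleSatSignsK ω i * tupleSatSignsK ω i = 1 := fun i => clauseSign_mul_self _
  have hD := isPseudoDensity_gsDensity (n := n) (b := tupleSatSignsK ω) (d := 2 * d) hvec
    (by norm_num) hdN (by linarith) hb
  have h0 := hD.cubeExpect_mul_nonneg hsub
  have h1 := one_le_cubeExpect_gsDensity_mul_predInstanceK_val hP ω hm hexp hN2 hdN hkd'
  rw [cubeExpect_mul_sub, cubeExpect_mul_const, hD.1] at h0
  linarith

/-- In `(c,s)`-approximation currency: the degree-`d` sum-of-squares relaxation, `d ≤ ⌊c_ε n⌋`,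
fails to `(c, |P⁻¹(1)|/2^k + ε)`-approximate Max-`k`-CSP(`P`), `c < 1`.
[cite: Tulsiani2009, proof of Thm 4.11 (p. 19–20)] -/
theorem Schoenebeck2008_parityImplied_not_achievesApprox (hk : 3 ≤ k) {P : (Fin k → Bool) → Bool}
    (hP : ∀ y, xorK k y = true → P y = true) {ε : ℝ} (hε : 0 < ε) :
    ∃ cε : ℝ, 0 < cε ∧ ∃ n₀ : ℕ, ∀ n : ℕ, n₀ ≤ n → ∀ d : ℕ, d ≤ ⌊cε * n⌋₊ →
      ∀ c : ℝ, c < 1 →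
        ¬ AchievesApprox (literalClosure P) (degreeLE n (d / 2)) c
          (((univ : Finset (Fin k → Bool)).filter fun y => P y = true).card / 2 ^ k + ε) := by
  obtain ⟨cε, hcε, n₀, H⟩ := Schoenebeck2008_parityImplied_sos hk hP ε hε
  refine ⟨cε, hcε, n₀, fun n hn d hd c hc hA => ?_⟩
  obtain ⟨I, hI, hnot⟩ := H n hn
  have h1 : SubspaceSos (degreeLE n (d / 2)) I.val c := hA I hI
  rw [subspaceSos_degreeLE_iff] at h1
  exact hnot c hc (h1.of_degree_le hd)

/-- **LRS Thm 1.6 × Tulsiani/Schoenebeck: polynomial-size SDP relaxations of Max-`k`-CSP(`P`), `P`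
implied by parity, cannot beat the random-assignment threshold `|P⁻¹(1)|/2^k` — PROVED** (every
`k ≥ 3`; `s > |P⁻¹(1)|/2^k`, `c < 1`, `dim U ≤ n^C`).
[cite: LeeRaghavendraSteurer2015, Thm 1.6 (p. 6)] [cite: Tulsiani2009, Thm 4.11 (proof)] -/
theorem LeeRaghavendraSteurer2015_parityImplied_poly (hk : 3 ≤ k) {P : (Fin k → Bool) → Bool}
    (hP : ∀ y, xorK k y = true → P y = true) :
    ∀ s : ℝ, (((univ : Finset (Fin k → Bool)).filter fun y => P y = true).card / 2 ^ k : ℝ) < s →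
      ∀ c : ℝ, c < 1 → ∀ C : ℕ, ∃ n₀ : ℕ, ∀ n : ℕ, n₀ ≤ n →
      ∀ U : Submodule ℝ ((Fin n → Bool) → ℝ), (Module.finrank ℝ U : ℝ) ≤ (n : ℝ) ^ C →
        ¬ AchievesApprox (literalClosure P) (U : Set ((Fin n → Bool) → ℝ)) c s :=
  LeeRaghavendraSteurer2015_poly_of_linearSosGap (literalClosure P)
    fun _ hε => Schoenebeck2008_parityImplied_not_achievesApprox hk hP hε

/-- **LRS Thm 1.5 for Max-`k`-CSP(`P`), `P` implied by parity, every `k ≥ 3` — PROVED:** no SDP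
relaxation of size `≤ n^{α log n / log log n}` achieves a `(c,s)`-approximation,
`|P⁻¹(1)|/2^k < s < c < 1`. [cite: LeeRaghavendraSteurer2015, Thm 1.5 (p. 6) and its proof (p. 26–27)]
[cite: Tulsiani2009, Thm 4.11 (proof)] -/
theorem LeeRaghavendraSteurer2015_parityImplied_quasipoly (hk : 3 ≤ k) {P : (Fin k → Bool) → Bool}
    (hP : ∀ y, xorK k y = true → P y = true) :
    ∃ α : ℝ, 0 < α ∧
      ∀ s : ℝ, (((univ : Finset (Fin k → Bool)).filter fun y => P y = true).card / 2 ^ k : ℝ) < s →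
      ∀ c : ℝ, s < c → c < 1 →
      ∃ n₀ : ℕ, ∀ n : ℕ, n₀ ≤ n → ∀ U : Submodule ℝ ((Fin n → Bool) → ℝ),
        (Module.finrank ℝ U : ℝ) ≤ (n : ℝ) ^ (α * Real.log n / Real.log (Real.log n)) →
        ¬ AchievesApprox (literalClosure P) (U : Set ((Fin n → Bool) → ℝ)) c s :=
  LeeRaghavendraSteurer2015_quasipoly_of_linearSosGap hk (literalClosure P) (by positivity)
    fun _ hε => Schoenebeck2008_parityImplied_not_achievesApprox hk hP hε

end Literature.Combinatorics.Optimization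

end
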